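import Mathlib
import HarnessLib
import Summits.HubbardSuperconductivity.HubbardSuperconductivity.Theorems.KLProgrammeKLRegimeCountertermJacksonTranslate

/-!
# Route `KLProgramme`, crux K3 — gen-5 ENGINE child (`stub_twoLeg_step`, (E3a-MS) supplier, recipe (L)+(F), plan g12 STATUS l.1769):
# the HIGH PART of the Jackson frequency split — `(1 − 𝒥_d)F` and `(1 − 𝒥_d)²F`: derivatives commute, contraction with constant ≤ 4,
# and the JACKSON GAINS `(d+1)^{−1}, (d+1)^{−2}, (d+1)^{−3}, (d+1)^{−4}` on every derivative

Seat hubbard-kl-k3c3-p1 (g3), package (P1) of MS-DESIGN-NOTE §3–§4 (evidence #29 on stmt-…-19855).  In the (F) step of the (E3a-MS) witness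
each mean-free deep frame piece `g` is split at degree `d = 4ⁿ` into `jlow d g := 2𝒥_d g − 𝒥_d(𝒥_d g)` and `jhigh d g := (1 − 𝒥_d)² g`; the
slot-`m` budget needs, for the high part, BOTH the contraction bounds `‖Dʲ(jhigh d g)‖ ≤ 4·sup‖Dʲg‖` AND the gains
`‖Dʲ(jhigh d g)‖ ≤ C_l·(d+1)^{−l}·sup‖D^{j+l} g‖`, `l ≤ 4` (the gain `4^{−ln}` supplies the factor `4^{−n}` of `msBar n`); both with constants
independent of `d`, and NO kernel moment beyond the second is used (orders 3–4 by iterating the one-step gains of `…JacksonTranslate`).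

* `jhigh1 d F := F − 𝒥_d F`, `jhigh d F := jhigh1 d (jhigh1 d F)`, `jlow d F := 2𝒥_d F − 𝒥_d(𝒥_d F)`, `jlow_add_jhigh`;
* `jsmooth_package` (k3c3-p2's (J2) + the derivative identity, restated), `iteratedFDeriv_jhigh1_eq`;
* **`jhigh1_package`** (continuity, `Cᵐ`, contraction `2Bⱼ`, gains `π⁶/(d+1)·M`, `2π⁷/(d+1)²·M`),
  **`jhigh_package`** (contraction `4Bⱼ`; gains `2π⁶/(d+1)·B_{j+1}`, `4π⁷/(d+1)²·B_{j+2}`, `2π¹³/(d+1)³·B_{j+3}`, `4π¹⁴/(d+1)⁴·B_{j+4}`).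

Pure real analysis; nothing about the model.  The LOW part's Bernstein-type bound (derivatives on the kernel) and the `TrigPolyC4v` presentation
of `jlow` are the companion file.
-/

noncomputable section

namespace Summit.HubbardSuperconductivity.HubbardSuperconductivity.Theorems.KLRegimeSplit

set_option linter.dupNamespace false -- summit = problem name (single-conjunct summit), D-0017

open Real MeasureTheory Filter
open Literature.Analysis.Fourier.TrigApprox Literature.MathematicalPhysics.QuantumLattice

/-! ## §4 The high part `(1 − 𝒥_d)F`, its iterate `(1 − 𝒥_d)²F`, and the low part -/

section High

variable (d : ℕ)

variable {F : (Fin 2 → ℝ) → ℝ}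

/-- A function read through `EuclideanSpace` is continuous iff… (one direction): `F ∘ ofLp` continuous ⇒ `F` continuous. -/
theorem continuous_of_continuous_comp_ofLp {H : (Fin 2 → ℝ) → ℝ}
    (h : Continuous fun q : EuclideanSpace ℝ (Fin 2) => H (WithLp.ofLp q)) : Continuous H := by
  have e : H = (fun q : EuclideanSpace ℝ (Fin 2) => H (WithLp.ofLp q)) ∘ (WithLp.toLp 2) := by funext p; simp
  rw [e]; exact h.comp (PiLp.continuous_toLp 2 _)

/-- **The regularity package of the Jackson mean** (k3c3-p2's (J2), restated): for `F` continuous with `F ∘ ofLp ∈ Cᵐ`, `‖Dⁱ(F∘ofLp)‖ ≤ Bᵢ`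
(`i ≤ m`): `𝒥_dF` is continuous, `𝒥_dF ∘ ofLp ∈ Cᵐ` with the same bounds, and `Dʲ(𝒥_dF ∘ ofLp)(x) = ∫ J̃J̃ · Dʲ(F∘ofLp)(x − w)`. -/
theorem jsmooth_package (hF : Continuous F) {m : ℕ} (hG : ContDiff ℝ m (fun q : EuclideanSpace ℝ (Fin 2) => F (WithLp.ofLp q)))
    {B : ℕ → ℝ} (hB : ∀ i ≤ m, ∀ x, ‖iteratedFDeriv ℝ i (fun q : EuclideanSpace ℝ (Fin 2) => F (WithLp.ofLp q)) x‖ ≤ B i) :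
    Continuous (jsmooth d F) ∧
    ContDiff ℝ m (fun q : EuclideanSpace ℝ (Fin 2) => jsmooth d F (WithLp.ofLp q)) ∧
    (∀ j ≤ m, ∀ x, ‖iteratedFDeriv ℝ j (fun q : EuclideanSpace ℝ (Fin 2) => jsmooth d F (WithLp.ofLp q)) x‖ ≤ B j) ∧
    (∀ j ≤ m, ∀ x, iteratedFDeriv ℝ j (fun q : EuclideanSpace ℝ (Fin 2) => jsmooth d F (WithLp.ofLp q)) x =
      ∫ w, jweight d w • iteratedFDeriv ℝ j (fun q : EuclideanSpace ℝ (Fin 2) => F (WithLp.ofLp q)) (x - jshift w) ∂jmeas) := by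
  obtain ⟨hC, hbd⟩ := contDiff_jsmooth_and_norm_iteratedFDeriv_le d hF hG hB
  have hfun : (fun q : EuclideanSpace ℝ (Fin 2) => jsmooth d F (WithLp.ofLp q)) =
      fun q => ∫ w, jweight d w • (fun x : EuclideanSpace ℝ (Fin 2) => F (WithLp.ofLp x)) (q - jshift w) ∂jmeas :=
    funext fun q => jsmooth_eq_integral_translate d hF q
  have hC' : ∀ w : ℝ × ℝ, |jweight d w| ≤ (π ^ 4 * (d + 1) / 8 / (2 * π)) * (π ^ 4 * (d + 1) / 8 / (2 * π)) :=
    fun w => by rw [abs_of_nonneg (jweight_nonneg d w)]; exact jweight_le d w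
  have hid := (contDiff_integral_translate (μ := jmeas) (continuous_jweight d) continuous_jshift hC' hG hB).2
  refine ⟨continuous_of_continuous_comp_ofLp hC.continuous, hC, hbd, fun j hj x => ?_⟩
  rw [hfun]
  exact hid j hj x

/-- **The derivative of the high part as a weighted translate integral**:
`Dʲ((F − 𝒥_dF) ∘ ofLp)(x) = −∫ J̃J̃ · (DʲG(x − w) − DʲG(x))`, `G = F ∘ ofLp`. -/
theorem iteratedFDeriv_jhigh1_eq (hF : Continuous F) {m : ℕ}
    (hG : ContDiff ℝ m (fun q : EuclideanSpace ℝ (Fin 2) => F (WithLp.ofLp q)))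
    {B : ℕ → ℝ} (hB : ∀ i ≤ m, ∀ x, ‖iteratedFDeriv ℝ i (fun q : EuclideanSpace ℝ (Fin 2) => F (WithLp.ofLp q)) x‖ ≤ B i)
    {j : ℕ} (hj : j ≤ m) (x : EuclideanSpace ℝ (Fin 2)) :
    iteratedFDeriv ℝ j (fun q : EuclideanSpace ℝ (Fin 2) => jhigh1 d F (WithLp.ofLp q)) x =
      -∫ w, jweight d w • (iteratedFDeriv ℝ j (fun q : EuclideanSpace ℝ (Fin 2) => F (WithLp.ofLp q)) (x - jshift w) -
        iteratedFDeriv ℝ j (fun q : EuclideanSpace ℝ (Fin 2) => F (WithLp.ofLp q)) x) ∂jmeas := by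
  obtain ⟨_, hC, hbd, hid⟩ := jsmooth_package d hF hG hB
  set G : EuclideanSpace ℝ (Fin 2) → ℝ := fun q => F (WithLp.ofLp q) with hGdef
  set GP : EuclideanSpace ℝ (Fin 2) → ℝ := fun q => jsmooth d F (WithLp.ofLp q) with hGPdef
  have hfun : (fun q : EuclideanSpace ℝ (Fin 2) => jhigh1 d F (WithLp.ofLp q)) = G - GP := by
    funext q; simp [jhigh1, hGdef, hGPdef]
  rw [hfun, iteratedFDeriv_sub_apply ((hG.of_le (by exact_mod_cast hj)).contDiffAt) ((hC.of_le (by exact_mod_cast hj)).contDiffAt),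
    hid j hj x]
  have hHc : Continuous (iteratedFDeriv ℝ j G) := hG.continuous_iteratedFDeriv (by exact_mod_cast hj)
  have i1 : Integrable (fun w : ℝ × ℝ => jweight d w • iteratedFDeriv ℝ j G (x - jshift w)) jmeas :=
    integrable_jmeas_of_continuous ((continuous_jweight d).smul (hHc.comp (continuous_const.sub continuous_jshift)))
  have i2 : Integrable (fun w : ℝ × ℝ => jweight d w • iteratedFDeriv ℝ j G x) jmeas :=
    (integrable_jmeas_of_continuous (continuous_jweight d)).smul_const _
  rw [← integral_neg, show (fun w : ℝ × ℝ => -(jweight d w • (iteratedFDeriv ℝ j G (x - jshift w) - iteratedFDeriv ℝ j G x))) =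
      fun w => jweight d w • iteratedFDeriv ℝ j G x - jweight d w • iteratedFDeriv ℝ j G (x - jshift w) from
      funext fun w => by rw [smul_sub]; abel,
    integral_sub i2 i1, integral_jweight_smul_const]

/-- **THE HIGH PART AFTER ONE STEP: contraction and the Jackson gains of orders 1 and 2.**  For `F` continuous with `G = F∘ofLp ∈ Cᵐ`,
`‖DⁱG‖ ≤ Bᵢ` (`i ≤ m`) — the regularity package — `jhigh1 d F = F − 𝒥_dF` is continuous, `∘ ofLp ∈ Cᵐ`, and for `j ≤ m`:
`‖Dʲ(jhigh1∘ofLp)(x)‖ ≤ 2Bⱼ`; if moreover `‖D^{j+1}G‖ ≤ M` (`j+1 ≤ m`) then `≤ π⁶/(d+1)·M`; if `‖D^{j+2}G‖ ≤ M` (`j+2 ≤ m`) then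
`≤ 2π⁷/(d+1)²·M`. -/
theorem jhigh1_package (hF : Continuous F) {m : ℕ}
    (hG : ContDiff ℝ m (fun q : EuclideanSpace ℝ (Fin 2) => F (WithLp.ofLp q)))
    {B : ℕ → ℝ} (hB : ∀ i ≤ m, ∀ x, ‖iteratedFDeriv ℝ i (fun q : EuclideanSpace ℝ (Fin 2) => F (WithLp.ofLp q)) x‖ ≤ B i) :
    Continuous (jhigh1 d F) ∧
    ContDiff ℝ m (fun q : EuclideanSpace ℝ (Fin 2) => jhigh1 d F (WithLp.ofLp q)) ∧
    (∀ j ≤ m, ∀ x, ‖iteratedFDeriv ℝ j (fun q : EuclideanSpace ℝ (Fin 2) => jhigh1 d F (WithLp.ofLp q)) x‖ ≤ 2 * B j) ∧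
    (∀ j, j + 1 ≤ m → ∀ M : ℝ,
      (∀ y, ‖iteratedFDeriv ℝ (j + 1) (fun q : EuclideanSpace ℝ (Fin 2) => F (WithLp.ofLp q)) y‖ ≤ M) →
        ∀ x, ‖iteratedFDeriv ℝ j (fun q : EuclideanSpace ℝ (Fin 2) => jhigh1 d F (WithLp.ofLp q)) x‖ ≤ π ^ 6 / (d + 1) * M) ∧
    (∀ j, j + 2 ≤ m → ∀ M : ℝ,
      (∀ y, ‖iteratedFDeriv ℝ (j + 2) (fun q : EuclideanSpace ℝ (Fin 2) => F (WithLp.ofLp q)) y‖ ≤ M) →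
        ∀ x, ‖iteratedFDeriv ℝ j (fun q : EuclideanSpace ℝ (Fin 2) => jhigh1 d F (WithLp.ofLp q)) x‖ ≤
          2 * π ^ 7 / (d + 1) ^ 2 * M) := by
  obtain ⟨hPc, hC, hbd, hid⟩ := jsmooth_package d hF hG hB
  set G : EuclideanSpace ℝ (Fin 2) → ℝ := fun q => F (WithLp.ofLp q) with hGdef
  have hcont : Continuous (jhigh1 d F) := hF.sub hPc
  have hCD : ContDiff ℝ m (fun q : EuclideanSpace ℝ (Fin 2) => jhigh1 d F (WithLp.ofLp q)) := by
    have hfun : (fun q : EuclideanSpace ℝ (Fin 2) => jhigh1 d F (WithLp.ofLp q)) =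
        fun q => G q - jsmooth d F (WithLp.ofLp q) := by funext q; simp [jhigh1, hGdef]
    rw [hfun]; exact hG.sub hC
  refine ⟨hcont, hCD, fun j hj x => ?_, fun j hj M hM x => ?_, fun j hj M hM x => ?_⟩
  · -- contraction
    have hfun : (fun q : EuclideanSpace ℝ (Fin 2) => jhigh1 d F (WithLp.ofLp q)) =
        G - fun q => jsmooth d F (WithLp.ofLp q) := by funext q; simp [jhigh1, hGdef]
    rw [hfun, iteratedFDeriv_sub_apply ((hG.of_le (by exact_mod_cast hj)).contDiffAt) ((hC.of_le (by exact_mod_cast hj)).contDiffAt)]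
    calc ‖iteratedFDeriv ℝ j G x - iteratedFDeriv ℝ j (fun q => jsmooth d F (WithLp.ofLp q)) x‖
        ≤ ‖iteratedFDeriv ℝ j G x‖ + ‖iteratedFDeriv ℝ j (fun q => jsmooth d F (WithLp.ofLp q)) x‖ := norm_sub_le _ _
      _ ≤ B j + B j := add_le_add (hB j hj x) (hbd j hj x)
      _ = 2 * B j := by ring
  · -- first-order gain
    rw [iteratedFDeriv_jhigh1_eq d hF hG hB (by omega) x, norm_neg]
    have hH : ContDiff ℝ 1 (iteratedFDeriv ℝ j G) := hG.iteratedFDeriv_right (by exact_mod_cast (by omega : 1 + j ≤ m))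
    refine norm_integral_jweight_sub_le_first d hH (fun y => ?_) x
    rw [Literature.Analysis.FluidPDE.norm_iteratedFDeriv_iteratedFDeriv]; exact hM y
  · -- second-order gain
    rw [iteratedFDeriv_jhigh1_eq d hF hG hB (by omega) x, norm_neg]
    have hH : ContDiff ℝ 2 (iteratedFDeriv ℝ j G) := hG.iteratedFDeriv_right (by exact_mod_cast (by omega : 2 + j ≤ m))
    refine norm_integral_jweight_sub_le_second d hH (fun y => ?_) x
    rw [Literature.Analysis.FluidPDE.norm_iteratedFDeriv_iteratedFDeriv]; exact hM y

/-- **THE HIGH PART `(1 − 𝒥_d)²F`: contraction with constant 4 and the Jackson gains of orders 1–4.**  Under the regularity package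
(`F` continuous, `G = F∘ofLp ∈ Cᵐ`, `‖DⁱG‖ ≤ Bᵢ` for `i ≤ m`, `B` monotone is NOT assumed): `jhigh d F` is continuous with `∘ofLp ∈ Cᵐ` and,
at every `x` and `j ≤ m`: `‖Dʲ‖ ≤ 4Bⱼ`; `≤ 2π⁶/(d+1)·B_{j+1}` (`j+1 ≤ m`); `≤ 4π⁷/(d+1)²·B_{j+2}` (`j+2 ≤ m`); `≤ 2π¹³/(d+1)³·B_{j+3}` (`j+3 ≤ m`);
`≤ 4π¹⁴/(d+1)⁴·B_{j+4}` (`j+4 ≤ m`) — the gains are obtained by iterating the one-step gains, never a kernel moment beyond the second. -/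
theorem jhigh_package (hF : Continuous F) {m : ℕ}
    (hG : ContDiff ℝ m (fun q : EuclideanSpace ℝ (Fin 2) => F (WithLp.ofLp q)))
    {B : ℕ → ℝ} (hB : ∀ i ≤ m, ∀ x, ‖iteratedFDeriv ℝ i (fun q : EuclideanSpace ℝ (Fin 2) => F (WithLp.ofLp q)) x‖ ≤ B i) :
    Continuous (jhigh d F) ∧
    ContDiff ℝ m (fun q : EuclideanSpace ℝ (Fin 2) => jhigh d F (WithLp.ofLp q)) ∧
    (∀ j ≤ m, ∀ x, ‖iteratedFDeriv ℝ j (fun q : EuclideanSpace ℝ (Fin 2) => jhigh d F (WithLp.ofLp q)) x‖ ≤ 4 * B j) ∧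
    (∀ j, j + 1 ≤ m → ∀ x,
      ‖iteratedFDeriv ℝ j (fun q : EuclideanSpace ℝ (Fin 2) => jhigh d F (WithLp.ofLp q)) x‖ ≤ 2 * π ^ 6 / (d + 1) * B (j + 1)) ∧
    (∀ j, j + 2 ≤ m → ∀ x,
      ‖iteratedFDeriv ℝ j (fun q : EuclideanSpace ℝ (Fin 2) => jhigh d F (WithLp.ofLp q)) x‖ ≤
        4 * π ^ 7 / (d + 1) ^ 2 * B (j + 2)) ∧
    (∀ j, j + 3 ≤ m → ∀ x,
      ‖iteratedFDeriv ℝ j (fun q : EuclideanSpace ℝ (Fin 2) => jhigh d F (WithLp.ofLp q)) x‖ ≤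
        2 * π ^ 13 / (d + 1) ^ 3 * B (j + 3)) ∧
    (∀ j, j + 4 ≤ m → ∀ x,
      ‖iteratedFDeriv ℝ j (fun q : EuclideanSpace ℝ (Fin 2) => jhigh d F (WithLp.ofLp q)) x‖ ≤
        4 * π ^ 14 / (d + 1) ^ 4 * B (j + 4)) := by
  -- one step on `F`
  obtain ⟨h1c, h1C, h1bd, h1g1, h1g2⟩ := jhigh1_package d hF hG hB
  -- the second step on `F' = jhigh1 d F` with the package `(m, 2B)`
  obtain ⟨h2c, h2C, h2bd, h2g1, h2g2⟩ := jhigh1_package d h1c h1C (B := fun i => 2 * B i) h1bd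
  have hd : (0 : ℝ) < d + 1 := by positivity
  refine ⟨h2c, h2C, fun j hj x => ?_, fun j hj x => ?_, fun j hj x => ?_, fun j hj x => ?_, fun j hj x => ?_⟩
  · calc _ ≤ 2 * (2 * B j) := h2bd j hj x
      _ = 4 * B j := by ring
  · -- order 1: first-order gain on F' with M = 2B(j+1)
    calc _ ≤ π ^ 6 / (d + 1) * (2 * B (j + 1)) := h2g1 j hj _ (h1bd (j + 1) hj) x
      _ = 2 * π ^ 6 / (d + 1) * B (j + 1) := by ring
  · -- order 2: second-order gain on F' with M = 2B(j+2)
    calc _ ≤ 2 * π ^ 7 / (d + 1) ^ 2 * (2 * B (j + 2)) := h2g2 j hj _ (h1bd (j + 2) hj) x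
      _ = 4 * π ^ 7 / (d + 1) ^ 2 * B (j + 2) := by ring
  · -- order 3: second-order gain on F' with M = π⁶/(d+1)·B(j+3) (first-order gain of step one at order j+2)
    have hM : ∀ y, ‖iteratedFDeriv ℝ (j + 2) (fun q : EuclideanSpace ℝ (Fin 2) => jhigh1 d F (WithLp.ofLp q)) y‖ ≤
        π ^ 6 / (d + 1) * B (j + 3) := fun y => h1g1 (j + 2) (by omega) _ (hB (j + 3) (by omega)) y
    calc _ ≤ 2 * π ^ 7 / (d + 1) ^ 2 * (π ^ 6 / (d + 1) * B (j + 3)) := h2g2 j (by omega) _ hM x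
      _ = 2 * π ^ 13 / (d + 1) ^ 3 * B (j + 3) := by field_simp
  · -- order 4: second-order gain on F' with M = 2π⁷/(d+1)²·B(j+4) (second-order gain of step one at order j+2)
    have hM : ∀ y, ‖iteratedFDeriv ℝ (j + 2) (fun q : EuclideanSpace ℝ (Fin 2) => jhigh1 d F (WithLp.ofLp q)) y‖ ≤
        2 * π ^ 7 / (d + 1) ^ 2 * B (j + 4) := fun y => h1g2 (j + 2) (by omega) _ (hB (j + 4) (by omega)) y
    calc _ ≤ 2 * π ^ 7 / (d + 1) ^ 2 * (2 * π ^ 7 / (d + 1) ^ 2 * B (j + 4)) := h2g2 j (by omega) _ hM x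
      _ = 4 * π ^ 14 / (d + 1) ^ 4 * B (j + 4) := by (try field_simp); (try ring)

/-- **The split**: `jlow d F + jhigh d F = F` (pointwise), for `F` continuous with `F ∘ ofLp` continuous-package (needed only for the
continuity of `𝒥_dF`). -/
theorem jlow_add_jhigh (hF : Continuous F) (hP : Continuous (jsmooth d F)) (p : Fin 2 → ℝ) :
    jlow d F p + jhigh d F p = F p := by
  have h : jsmooth d (jhigh1 d F) p = jsmooth d F p - jsmooth d (jsmooth d F) p := jsmooth_sub d hF hP p
  simp only [jlow, jhigh, jhigh1] at h ⊢
  rw [h]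
  ring

end High

end Summit.HubbardSuperconductivity.HubbardSuperconductivity.Theorems.KLRegimeSplit

end
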